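import Mathlib
import Summits.MatrixMultiplication.MatrixMultiplication.Theorems.SnSubsetDichotomyPolynomialSlackPositionKeptBoundFarLemmas

/-!
# Per-position kept bound, far-rider version (constant `5/8`)

Crux `Summit.MatrixMultiplication.MatrixMultiplication.Theses.SnSubsetDichotomy.PolynomialSlack`
(item `stmt-MatrixMultiplication-8306`), level-one programme, line transport-split-hull (lead c10):
the abstract per-position inequality `position_kept_bound_far`, the far-rider sharpening of c9's
`position_kept_bound` (file `…PositionKeptBound`, constant `0.74`).  The only new hypothesis is that
hub pairs of substantial levels are penalised up to the LARGER area `A₁` (`log A₁ ≥ 1.24 Lg`, from the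
hub-of-area win `volume_le_of_hub_atom_of_area` at area `A₁ ≈ n^{1.245}`), not only up to `A₀`; riders
(overlapping non-productive pairs) must then be FAR (`log x + log y > 1.24 Lg`), which kills the
staircase extremisers of the old relaxation (supremum `(8-2√6)/5 ≈ 0.62` of the true LP drops to the
single-pair value `4 - 2√3 ≈ 0.536`; a three-class linear relaxation gives `≤ 0.602`).

Proof plan.  STEP A (classification, as c9): `∑ c ≤ E - Pen + ε₂ (∑σ')(∑ρ') + 2 ε₁ m (∑σ' + ∑ρ')`
with `E` the productive (depleted, included) mass and `Pen ≥ (225 M/(512 m²))·Hi²` the penalty of the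
`T`-pairs (substantial, `h ≥ h₁`, area `≤ A₁`), `Hi` their total overlap.  STEP F' (charging):
`E ≤ (100/99)·K₁`, `K₁ = xH·Y + xM·(YM+YH) + xC·YH + yH·X + yM·(XM+XH) + yC·XH`, where the included
levels are classed by cost rate `u = 1 - log x/Lg` into `C (u < 0.475)`, `M`, `H (u > 0.515)` with class
masses `X·` and class costs `x·` (productive pairs have `u + v ≥ 0.99` since `log A₀ ≤ 1.01 Lg`, so cheap
levels pair only with dear ones and mid levels only with mid or dear ones).  STEP D' (three budgets): the
rectangles `H × all`, `all × H`, `(M ∪ H)²` of included levels contain no far pair (`log x + log y ≤ 1.24 Lg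
≤ log A₁`), so their overlap is `T`-overlap plus `≤ h₁` per pair:
`XH + Y, X + YH, XM+XH+YM+YH ≤ 1 + Hi + m² h₁`.  STEP E' (scalar endgame): `hscalar`
(= `position_ratio_far`) with `δ := Hi + m² h₁`, then `(100/99) δ (X+Y) - Pen` is completed to a square.

The single-pair, class-bookkeeping, charging and scalar lemmas are in the sibling file
`…PositionKeptBoundFarLemmas` (`far_kept_*`); here `core` assembles them with the inclusion
predicates, the penalised relation and the log-sizes abstracted, and the registered statement
instantiates `core`.
-/

namespace Summit.MatrixMultiplication.MatrixMultiplication.Theorems.PolynomialSlack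

set_option linter.dupNamespace false

open scoped BigOperators

/-- The body of `position_kept_bound_far`, with the inclusion predicates `IA, IB`, the penalised
relation `T` (substantial hub pairs of area `≤ A₁`) and the log-sizes `la, lb` abstracted: all the
proof uses is that depleted pairs of substantial levels are included (`hI`), that depleted pairs
have `la + lb ≤ 1.01 Lg` (`hDepL`), that `T`-pairs are anti-kept (`hTc`), that included non-far
non-`T` pairs have hub mass `≤ h₁` (`hTn`), and the rate bounds of the included levels. -/
private theorem core {m : ℕ} (σ σ' la ρ ρ' lb : Fin m → ℝ) (h c : Fin m → Fin m → ℝ)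
    (Dep T : Fin m → Fin m → Prop) [DecidableRel Dep] [DecidableRel T] (IA IB : Fin m → Prop)
    [DecidablePred IA] [DecidablePred IB] (ε₁ ε₂ h₁ M Lg : ℝ) (hε₁ : 0 < ε₁) (hε₂ : 0 < ε₂)
    (hh₁ : 0 ≤ h₁) (hLg : 0 < Lg) (hM0 : 0 < M)
    (hσ : ∀ a, 0 ≤ σ a ∧ σ a ≤ σ' a ∧ 15 / 16 * σ' a ≤ σ a)
    (hρ : ∀ b, 0 ≤ ρ b ∧ ρ b ≤ ρ' b ∧ 15 / 16 * ρ' b ≤ ρ b) (hh0 : ∀ a b, 0 ≤ h a b)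
    (hhσ : ∀ a, ∑ b, h a b ≤ σ' a) (hhρ : ∀ b, ∑ a, h a b ≤ ρ' b)
    (hbudget : ∀ P Q : Finset (Fin m),
      ∑ a ∈ P, σ' a + ∑ b ∈ Q, ρ' b ≤ 1 + ∑ a ∈ P, ∑ b ∈ Q, h a b)
    (hc : ∀ a b, c a b ≤ σ' a * ρ' b) (hcdep : ∀ a b, ¬ Dep a b → c a b ≤ ε₂ * σ a * ρ b)
    (hDepL : ∀ a b, Dep a b → la a + lb b ≤ 101 / 100 * Lg)
    (hI : ∀ a b, ε₁ ≤ σ a → ε₁ ≤ ρ b → Dep a b → IA a ∧ IB b)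
    (hTc : ∀ a b, T a b → c a b ≤ -(M / 2) * σ a * ρ b)
    (hTn : ∀ a b, IA a → IB b → la a + lb b < 124 / 100 * Lg → ¬ T a b → h a b ≤ h₁)
    (hrx : ∀ a, IA a → 245 / 1000 * Lg ≤ la a ∧ la a ≤ 755 / 1000 * Lg)
    (hry : ∀ b, IB b → 245 / 1000 * Lg ≤ lb b ∧ lb b ≤ 755 / 1000 * Lg)
    (hscalar : ∀ XC XM XH YC YM YH xC xM xH yC yM yH δ : ℝ,
      0 ≤ XC → 0 ≤ XM → 0 ≤ XH → 0 ≤ YC → 0 ≤ YM → 0 ≤ YH → 0 ≤ δ →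
      XH + (YC + YM + YH) ≤ 1 + δ → (XC + XM + XH) + YH ≤ 1 + δ →
      XM + XH + YM + YH ≤ 1 + δ →
      (245 / 1000 * XC ≤ xC ∧ xC ≤ 475 / 1000 * XC) →
      (475 / 1000 * XM ≤ xM ∧ xM ≤ 515 / 1000 * XM) →
      (515 / 1000 * XH ≤ xH ∧ xH ≤ 755 / 1000 * XH) →
      (245 / 1000 * YC ≤ yC ∧ yC ≤ 475 / 1000 * YC) →
      (475 / 1000 * YM ≤ yM ∧ yM ≤ 515 / 1000 * YM) →
      (515 / 1000 * YH ≤ yH ∧ yH ≤ 755 / 1000 * YH) →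
      xH * (YC + YM + YH) + xM * (YM + YH) + xC * YH + yH * (XC + XM + XH) + yM * (XM + XH)
          + yC * XH
        ≤ 99 / 100 * (5 / 8) * (xC + xM + xH + yC + yM + yH) + δ * (XC + XM + XH + YC + YM + YH)) :
    ∑ a, ∑ b, c a b ≤ 5 / 8 * ((∑ a, if IA a then σ' a * (1 - la a / Lg) else 0)
        + (∑ b, if IB b then ρ' b * (1 - lb b / Lg) else 0))
      + (ε₂ * ((∑ a, σ' a) * (∑ b, ρ' b)) + 2 * ε₁ * m * ((∑ a, σ' a) + (∑ b, ρ' b))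
        + 2 * ((∑ a, σ' a) + (∑ b, ρ' b)) * ((m : ℝ) * m * h₁)
        + ((∑ a, σ' a) + (∑ b, ρ' b)) ^ 2 * ((m : ℝ) * m) / M) := by
  -- basic signs
  have hσ'0 : ∀ a, 0 ≤ σ' a := fun a => (hσ a).1.trans (hσ a).2.1
  have hρ'0 : ∀ b, 0 ≤ ρ' b := fun b => (hρ b).1.trans (hρ b).2.1
  have hhσ' : ∀ a b, h a b ≤ σ' a := fun a b =>
    (Finset.single_le_sum (f := fun b' => h a b') (fun b' _ => hh0 a b') (Finset.mem_univ b)).trans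
      (hhσ a)
  have hhρ' : ∀ a b, h a b ≤ ρ' b := fun a b =>
    (Finset.single_le_sum (f := fun a' => h a' b) (fun a' _ => hh0 a' b) (Finset.mem_univ a)).trans
      (hhρ b)
  -- included masses and costs, the included overlap kernel `G` and its `T` part
  set σ₁ : Fin m → ℝ := fun a => if IA a then σ' a else 0 with hσ₁
  set ρ₁ : Fin m → ℝ := fun b => if IB b then ρ' b else 0 with hρ₁
  set u : Fin m → ℝ := fun a => if IA a then σ' a * (1 - la a / Lg) else 0 with hu
  set v : Fin m → ℝ := fun b => if IB b then ρ' b * (1 - lb b / Lg) else 0 with hv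
  set G : Fin m → Fin m → ℝ := fun a b => if IA a ∧ IB b then h a b else 0 with hG
  set gi : Fin m → Fin m → ℝ := fun a b => if T a b then G a b else 0 with hgi
  clear_value σ₁ ρ₁ u v G gi
  have hσ₁0 : ∀ a, 0 ≤ σ₁ a := fun a => by simp only [hσ₁]; split_ifs; exacts [hσ'0 a, le_rfl]
  have hρ₁0 : ∀ b, 0 ≤ ρ₁ b := fun b => by simp only [hρ₁]; split_ifs; exacts [hρ'0 b, le_rfl]
  have hσ₁le : ∀ a, σ₁ a ≤ σ' a := fun a => by simp only [hσ₁]; split_ifs; exacts [le_rfl, hσ'0 a]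
  have hρ₁le : ∀ b, ρ₁ b ≤ ρ' b := fun b => by simp only [hρ₁]; split_ifs; exacts [le_rfl, hρ'0 b]
  have hσ₁I : ∀ a, σ₁ a ≠ 0 → IA a := fun a => by
    simp only [hσ₁]; split_ifs with h; exacts [fun _ => h, fun h' => absurd rfl h']
  have hρ₁I : ∀ b, ρ₁ b ≠ 0 → IB b := fun b => by
    simp only [hρ₁]; split_ifs with h; exacts [fun _ => h, fun h' => absurd rfl h']
  have hu' : ∀ a, u a = σ₁ a * (1 - la a / Lg) := fun a => by
    simp only [hu, hσ₁]; split_ifs <;> simp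
  have hv' : ∀ b, v b = ρ₁ b * (1 - lb b / Lg) := fun b => by
    simp only [hv, hρ₁]; split_ifs <;> simp
  have hu0 : ∀ a, 0 ≤ u a := fun a => by
    rw [hu' a]
    rcases eq_or_ne (σ₁ a) 0 with h0 | h0
    · rw [h0, zero_mul]
    · refine mul_nonneg (hσ₁0 a) ?_
      have : la a / Lg ≤ 755 / 1000 := by rw [div_le_iff₀ hLg]; exact (hrx a (hσ₁I a h0)).2
      linarith
  have hv0 : ∀ b, 0 ≤ v b := fun b => by
    rw [hv' b]
    rcases eq_or_ne (ρ₁ b) 0 with h0 | h0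
    · rw [h0, zero_mul]
    · refine mul_nonneg (hρ₁0 b) ?_
      have : lb b / Lg ≤ 755 / 1000 := by rw [div_le_iff₀ hLg]; exact (hry b (hρ₁I b h0)).2
      linarith
  have hG0 : ∀ a b, 0 ≤ G a b := fun a b => by simp only [hG]; split_ifs; exacts [hh0 a b, le_rfl]
  have hGle : ∀ a b, G a b ≤ h a b :=
    fun a b => by simp only [hG]; split_ifs; exacts [le_rfl, hh0 a b]
  have hgi0 : ∀ a b, 0 ≤ gi a b :=
    fun a b => by simp only [hgi]; split_ifs; exacts [hG0 a b, le_rfl]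
  -- STEP A: classification of the pairs
  have hstepA : ∑ a, ∑ b, c a b ≤ (∑ a, ∑ b, if Dep a b then σ₁ a * ρ₁ b else 0)
      - (∑ a, ∑ b, if T a b then M / 2 * (σ a * ρ b) else 0)
      + ε₂ * ((∑ a, σ' a) * (∑ b, ρ' b)) + 2 * ε₁ * m * ((∑ a, σ' a) + (∑ b, ρ' b)) := by
    calc ∑ a, ∑ b, c a b ≤ ∑ a, ∑ b, ((if Dep a b then σ₁ a * ρ₁ b else 0)
          - (if T a b then M / 2 * (σ a * ρ b) else 0)
          + ε₂ * (σ' a * ρ' b) + (2 * ε₁ * ρ' b + 2 * ε₁ * σ' a)) :=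
          Finset.sum_le_sum fun a _ => Finset.sum_le_sum fun b _ =>
            far_kept_pair_bound hε₁ hε₂ (hσ a) (hρ b) (hσ₁0 a) (hρ₁0 b)
              (fun ha hb hd => by
                obtain ⟨hia, hib⟩ := hI a b ha hb hd
                simp only [hσ₁, hρ₁, if_pos hia, if_pos hib])
              (hc a b) (hcdep a b) (hTc a b)
      _ = _ := by
          simp only [Finset.sum_add_distrib, Finset.sum_sub_distrib, ← Finset.mul_sum,
            ← Finset.sum_mul, Finset.sum_const, Finset.card_univ, Fintype.card_fin, nsmul_eq_mul]
          ring
  -- STEP C: the penalty dominates `(225/512) M ∑ gi²`, and Cauchy–Schwarz over the `m·m` pairs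
  have hC1 : ∀ a b, 225 / 512 * M * gi a b ^ 2 ≤ (if T a b then M / 2 * (σ a * ρ b) else 0) := by
    intro a b
    obtain ⟨hσ0, -, hσ15⟩ := hσ a
    obtain ⟨-, -, hρ15⟩ := hρ b
    simp only [hgi]
    split_ifs with ht
    · have h3 : G a b ^ 2 ≤ σ' a * ρ' b := by
        rw [sq]
        exact mul_le_mul ((hGle a b).trans (hhσ' a b)) ((hGle a b).trans (hhρ' a b)) (hG0 a b)
          (hσ'0 a)
      have h4 : 15 / 16 * σ' a * (15 / 16 * ρ' b) ≤ σ a * ρ b :=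
        mul_le_mul hσ15 hρ15 (by linarith [hρ'0 b]) hσ0
      have h5 : 225 / 256 * G a b ^ 2 ≤ σ a * ρ b := by linarith
      linarith [mul_le_mul_of_nonneg_left h5 hM0.le]
    · simp
  have hPen : 225 / 512 * M * (∑ a, ∑ b, gi a b ^ 2)
      ≤ ∑ a, ∑ b, (if T a b then M / 2 * (σ a * ρ b) else 0) := by
    rw [Finset.mul_sum]
    refine Finset.sum_le_sum fun a _ => ?_
    rw [Finset.mul_sum]
    exact Finset.sum_le_sum fun b _ => hC1 a b
  have hCS := far_kept_sq_sum_sum_le gi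
  have hQ0 : 0 ≤ ∑ a, ∑ b, gi a b ^ 2 :=
    Finset.sum_nonneg fun a _ => Finset.sum_nonneg fun b _ => sq_nonneg _
  have hHi0 : 0 ≤ ∑ a, ∑ b, gi a b :=
    Finset.sum_nonneg fun a _ => Finset.sum_nonneg fun b _ => hgi0 a b
  -- STEP D': the budget on a rectangle of included levels without far pairs
  have hbud : ∀ (PA PB : Fin m → Prop) [DecidablePred PA] [DecidablePred PB],
      (∀ a b, IA a → PA a → IB b → PB b → la a + lb b < 124 / 100 * Lg) →
      (∑ a, if PA a then σ₁ a else 0) + (∑ b, if PB b then ρ₁ b else 0)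
        ≤ 1 + ((∑ a, ∑ b, gi a b) + (m : ℝ) * m * h₁) := by
    intro PA PB _ _ hfar
    have hD := hbudget (Finset.univ.filter fun a => IA a ∧ PA a)
      (Finset.univ.filter fun b => IB b ∧ PB b)
    simp only [Finset.sum_filter] at hD
    have e1 : ∀ a, (if IA a ∧ PA a then σ' a else 0) = if PA a then σ₁ a else 0 := fun a => by
      simp only [hσ₁]
      by_cases h1 : IA a <;> by_cases h2 : PA a <;> simp [h1, h2]
    have e2 : ∀ b, (if IB b ∧ PB b then ρ' b else 0) = if PB b then ρ₁ b else 0 := fun b => by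
      simp only [hρ₁]
      by_cases h1 : IB b <;> by_cases h2 : PB b <;> simp [h1, h2]
    have e3 : ∀ a, (if IA a ∧ PA a then ∑ b, (if IB b ∧ PB b then h a b else 0) else 0)
        ≤ ∑ b, (gi a b + h₁) := fun a => by
      split_ifs with ha
      · refine Finset.sum_le_sum fun b _ => ?_
        split_ifs with hb
        · by_cases ht : T a b
          · have : gi a b = h a b := by
              simp only [hgi, hG, if_pos ht, if_pos (And.intro ha.1 hb.1)]
            linarith
          · linarith [hTn a b ha.1 hb.1 (hfar a b ha.1 ha.2 hb.1 hb.2) ht, hgi0 a b]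
        · linarith [hgi0 a b]
      · exact Finset.sum_nonneg fun b _ => by linarith [hgi0 a b]
    have e4 : ∑ a, ∑ b, (gi a b + h₁) = (∑ a, ∑ b, gi a b) + (m : ℝ) * m * h₁ := by
      simp only [Finset.sum_add_distrib, Finset.sum_const, Finset.card_univ, Fintype.card_fin,
        nsmul_eq_mul]
      ring
    simp only [e1, e2] at hD
    calc (∑ a, if PA a then σ₁ a else 0) + (∑ b, if PB b then ρ₁ b else 0)
        ≤ 1 + ∑ a, (if IA a ∧ PA a then ∑ b, (if IB b ∧ PB b then h a b else 0) else 0) := hD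
      _ ≤ 1 + ∑ a, ∑ b, (gi a b + h₁) := by
          linarith [Finset.sum_le_sum fun a (_ : a ∈ Finset.univ) => e3 a]
      _ = _ := by rw [e4]
  have hB1 := hbud (fun a => la a < 485 / 1000 * Lg) (fun _ => True)
    fun a b _ (ha : la a < 485 / 1000 * Lg) hb _ => by linarith [(hry b hb).2]
  have hB2 := hbud (fun _ => True) (fun b => lb b < 485 / 1000 * Lg)
    fun a b ha _ _ (hb : lb b < 485 / 1000 * Lg) => by linarith [(hrx a ha).2]
  have hB3 := hbud (fun a => la a ≤ 525 / 1000 * Lg) (fun b => lb b ≤ 525 / 1000 * Lg)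
    fun a b _ (ha : la a ≤ 525 / 1000 * Lg) _ (hb : lb b ≤ 525 / 1000 * Lg) => by linarith
  simp only [ite_true] at hB1 hB2
  -- STEP F': charging the productive pairs to the class costs
  have hF1 : ∀ a b, 99 / 100 * (if Dep a b then σ₁ a * ρ₁ b else 0)
      ≤ (if Dep a b then u a * ρ₁ b else 0) + (if Dep a b then v b * σ₁ a else 0) := by
    intro a b
    by_cases hd : Dep a b
    · simp only [if_pos hd]
      by_cases hab : IA a ∧ IB b
      · obtain ⟨ha, hb⟩ := hab
        have hL : la a / Lg + lb b / Lg ≤ 101 / 100 := by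
          rw [← add_div, div_le_iff₀ hLg]; linarith [hDepL a b hd]
        have hP : 0 ≤ σ' a * ρ' b := mul_nonneg (hσ'0 a) (hρ'0 b)
        simp only [hu, hv, hσ₁, hρ₁, if_pos ha, if_pos hb]
        linarith [mul_le_mul_of_nonneg_left hL hP]
      · have h0 : σ₁ a * ρ₁ b = 0 := by
          simp only [hσ₁, hρ₁]
          rcases not_and_or.1 hab with h' | h' <;> simp [h']
        rw [h0]
        linarith [mul_nonneg (hu0 a) (hρ₁0 b), mul_nonneg (hv0 b) (hσ₁0 a)]
    · simp only [if_neg hd]; linarith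
  have hE2 : 99 / 100 * (∑ a, ∑ b, if Dep a b then σ₁ a * ρ₁ b else 0)
      ≤ (∑ a, ∑ b, if Dep a b then u a * ρ₁ b else 0)
        + (∑ a, ∑ b, if Dep a b then v b * σ₁ a else 0) := by
    have h1 : ∀ a, 99 / 100 * (∑ b, if Dep a b then σ₁ a * ρ₁ b else 0)
        ≤ (∑ b, if Dep a b then u a * ρ₁ b else 0)
          + (∑ b, if Dep a b then v b * σ₁ a else 0) := fun a => by
      rw [Finset.mul_sum, ← Finset.sum_add_distrib]
      exact Finset.sum_le_sum fun b _ => hF1 a b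
    rw [Finset.mul_sum, ← Finset.sum_add_distrib]
    exact Finset.sum_le_sum fun a _ => h1 a
  have hchA := far_kept_charge_le u la ρ₁ lb Dep Lg hu0 hρ₁0 hDepL
  have hchB := far_kept_charge_le v lb σ₁ la (fun b a => Dep a b) Lg hv0 hσ₁0
    fun b a hd => by rw [add_comm]; exact hDepL a b hd
  rw [Finset.sum_comm] at hchB
  -- the class bookkeeping of both sides
  have hXs := far_kept_split3 σ₁ la hLg
  have hxs := far_kept_split3 u la hLg
  have hYs := far_kept_split3 ρ₁ lb hLg
  have hys := far_kept_split3 v lb hLg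
  have hXMH := far_kept_split2 σ₁ la hLg
  have hYMH := far_kept_split2 ρ₁ lb hLg
  obtain ⟨hbxC, hbxM, hbxH⟩ :=
    far_kept_boxes σ₁ u la hLg hσ₁0 hu' fun a ha => hrx a (hσ₁I a ha)
  obtain ⟨hbyC, hbyM, hbyH⟩ :=
    far_kept_boxes ρ₁ v lb hLg hρ₁0 hv' fun b hb => hry b (hρ₁I b hb)
  have hXle : ∑ a, σ₁ a ≤ ∑ a, σ' a := Finset.sum_le_sum fun a _ => hσ₁le a
  have hYle : ∑ b, ρ₁ b ≤ ∑ b, ρ' b := Finset.sum_le_sum fun b _ => hρ₁le b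
  -- names for the class masses and costs, the `T`-overlap and the productive mass
  set XC := ∑ a, if 525 / 1000 * Lg < la a then σ₁ a else 0
  set XM := ∑ a, if 485 / 1000 * Lg ≤ la a ∧ la a ≤ 525 / 1000 * Lg then σ₁ a else 0
  set XH := ∑ a, if la a < 485 / 1000 * Lg then σ₁ a else 0
  set YC := ∑ b, if 525 / 1000 * Lg < lb b then ρ₁ b else 0
  set YM := ∑ b, if 485 / 1000 * Lg ≤ lb b ∧ lb b ≤ 525 / 1000 * Lg then ρ₁ b else 0
  set YH := ∑ b, if lb b < 485 / 1000 * Lg then ρ₁ b else 0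
  set xC := ∑ a, if 525 / 1000 * Lg < la a then u a else 0
  set xM := ∑ a, if 485 / 1000 * Lg ≤ la a ∧ la a ≤ 525 / 1000 * Lg then u a else 0
  set xH := ∑ a, if la a < 485 / 1000 * Lg then u a else 0
  set yC := ∑ b, if 525 / 1000 * Lg < lb b then v b else 0
  set yM := ∑ b, if 485 / 1000 * Lg ≤ lb b ∧ lb b ≤ 525 / 1000 * Lg then v b else 0
  set yH := ∑ b, if lb b < 485 / 1000 * Lg then v b else 0
  set Hi := ∑ a, ∑ b, gi a b
  set E := ∑ a, ∑ b, if Dep a b then σ₁ a * ρ₁ b else 0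
  have hXC0 : 0 ≤ XC := Finset.sum_nonneg fun a _ => by split_ifs; exacts [hσ₁0 a, le_rfl]
  have hXM0 : 0 ≤ XM := Finset.sum_nonneg fun a _ => by split_ifs; exacts [hσ₁0 a, le_rfl]
  have hXH0 : 0 ≤ XH := Finset.sum_nonneg fun a _ => by split_ifs; exacts [hσ₁0 a, le_rfl]
  have hYC0 : 0 ≤ YC := Finset.sum_nonneg fun b _ => by split_ifs; exacts [hρ₁0 b, le_rfl]
  have hYM0 : 0 ≤ YM := Finset.sum_nonneg fun b _ => by split_ifs; exacts [hρ₁0 b, le_rfl]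
  have hYH0 : 0 ≤ YH := Finset.sum_nonneg fun b _ => by split_ifs; exacts [hρ₁0 b, le_rfl]
  -- STEP E': the scalar inequality and the endgame
  have hB1' : XH + (YC + YM + YH) ≤ 1 + (Hi + (m : ℝ) * m * h₁) := by linarith
  have hB2' : (XC + XM + XH) + YH ≤ 1 + (Hi + (m : ℝ) * m * h₁) := by linarith
  have hB3' : XM + XH + YM + YH ≤ 1 + (Hi + (m : ℝ) * m * h₁) := by linarith
  have hδ0 : 0 ≤ Hi + (m : ℝ) * m * h₁ := add_nonneg hHi0 (mul_nonneg (mul_self_nonneg _) hh₁)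
  have hsc := hscalar XC XM XH YC YM YH xC xM xH yC yM yH (Hi + (m : ℝ) * m * h₁)
    hXC0 hXM0 hXH0 hYC0 hYM0 hYH0 hδ0 hB1' hB2' hB3' hbxC hbxM hbxH hbyC hbyM hbyH
  have hEK : 99 / 100 * E ≤ 99 / 100 * (5 / 8) * (xC + xM + xH + yC + yM + yH)
      + (Hi + (m : ℝ) * m * h₁) * (XC + XM + XH + YC + YM + YH) := by
    linarith
  have hW0 : 0 ≤ XC + XM + XH + YC + YM + YH := by linarith
  have hWS : XC + XM + XH + YC + YM + YH ≤ (∑ a, σ' a) + (∑ b, ρ' b) := by linarith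
  have hfin := far_kept_real_core hstepA hEK hPen hCS hQ0 hHi0 hW0 hWS
    (mul_nonneg (mul_self_nonneg (m : ℝ)) hh₁) hM0 (mul_self_nonneg (m : ℝ))
  linarith

/-- **Per-position kept bound, far-rider version.**  Level data on `Fin m` as in
`position_kept_bound` (T-levels `a`: masses `σ ≤ σ'`, block sizes `x`; S-levels `b`: `ρ, ρ', y`;
hub masses `h` with the sub-partition budget; kept values `c ≤ σ' ρ'`; depletion relation `Dep`;
non-depleted pairs keep `≤ ε₂ σ ρ`; depleted pairs have area `≤ A₀`, `log A₀ ≤ 1.01 Lg`; levels of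
depleted substantial pairs have `log x, log y ∈ [0.245, 0.755] Lg`), with the hub penalty now for ALL
substantial hub pairs of area `≤ A₁`, `log A₁ ≥ 1.24 Lg` (`hpen`), and the scalar inequality
`position_ratio_far` supplied as `hscalar`.  Then
`∑ c ≤ (5/8)·cost + ε₂ (∑σ')(∑ρ') + 2 ε₁ m (∑σ'+∑ρ') + 2 (∑σ'+∑ρ') m² h₁ + (∑σ'+∑ρ')² m²/M`,
`cost = ∑_incl σ'(1 - log x/Lg) + ∑_incl ρ'(1 - log y/Lg)`. -/
theorem position_kept_bound_far {m : ℕ} (σ σ' x : Fin m → ℝ) (ρ ρ' y : Fin m → ℝ)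
    (h c : Fin m → Fin m → ℝ) (Dep : Fin m → Fin m → Prop) [DecidableRel Dep]
    (ε₁ ε₂ h₁ M A₀ A₁ Lg : ℝ) (hε₁ : 0 < ε₁) (hε₂ : 0 < ε₂) (hh₁ : 0 < h₁) (hLg : 0 < Lg)
    (hM : 56 * ((m : ℝ) * m) ≤ M) (hM0 : 0 < M)
    (hA₀ : Real.log A₀ ≤ 101 / 100 * Lg) (hA₁ : 124 / 100 * Lg ≤ Real.log A₁) (hA₀₁ : A₀ ≤ A₁)
    (hx : ∀ a, 1 ≤ x a) (hy : ∀ b, 1 ≤ y b)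
    (hσ : ∀ a, 0 ≤ σ a ∧ σ a ≤ σ' a ∧ 15 / 16 * σ' a ≤ σ a)
    (hρ : ∀ b, 0 ≤ ρ b ∧ ρ b ≤ ρ' b ∧ 15 / 16 * ρ' b ≤ ρ b) (hh0 : ∀ a b, 0 ≤ h a b)
    (hhσ : ∀ a, ∑ b, h a b ≤ σ' a) (hhρ : ∀ b, ∑ a, h a b ≤ ρ' b)
    (hbudget : ∀ (P Q : Finset (Fin m)),
      ∑ a ∈ P, σ' a + ∑ b ∈ Q, ρ' b ≤ 1 + ∑ a ∈ P, ∑ b ∈ Q, h a b)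
    (hc : ∀ a b, c a b ≤ σ' a * ρ' b) (hcdep : ∀ a b, ¬ Dep a b → c a b ≤ ε₂ * σ a * ρ b)
    (hpen : ∀ a b, ε₁ ≤ σ a → ε₁ ≤ ρ b → h₁ ≤ h a b → x a * y b ≤ A₁ →
      c a b ≤ -(M / 2) * σ a * ρ b)
    (hsmall : ∀ a b, Dep a b → x a * y b ≤ A₀)
    (hratex : ∀ a, ε₁ ≤ σ a → (∃ b, ε₁ ≤ ρ b ∧ Dep a b) →
      245 / 1000 * Lg ≤ Real.log (x a) ∧ Real.log (x a) ≤ 755 / 1000 * Lg)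
    (hratey : ∀ b, ε₁ ≤ ρ b → (∃ a, ε₁ ≤ σ a ∧ Dep a b) →
      245 / 1000 * Lg ≤ Real.log (y b) ∧ Real.log (y b) ≤ 755 / 1000 * Lg)
    (hscalar : ∀ XC XM XH YC YM YH xC xM xH yC yM yH δ : ℝ,
      0 ≤ XC → 0 ≤ XM → 0 ≤ XH → 0 ≤ YC → 0 ≤ YM → 0 ≤ YH → 0 ≤ δ →
      XH + (YC + YM + YH) ≤ 1 + δ → (XC + XM + XH) + YH ≤ 1 + δ →
      XM + XH + YM + YH ≤ 1 + δ →
      (245 / 1000 * XC ≤ xC ∧ xC ≤ 475 / 1000 * XC) →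
      (475 / 1000 * XM ≤ xM ∧ xM ≤ 515 / 1000 * XM) →
      (515 / 1000 * XH ≤ xH ∧ xH ≤ 755 / 1000 * XH) →
      (245 / 1000 * YC ≤ yC ∧ yC ≤ 475 / 1000 * YC) →
      (475 / 1000 * YM ≤ yM ∧ yM ≤ 515 / 1000 * YM) →
      (515 / 1000 * YH ≤ yH ∧ yH ≤ 755 / 1000 * YH) →
      xH * (YC + YM + YH) + xM * (YM + YH) + xC * YH + yH * (XC + XM + XH) + yM * (XM + XH) + yC * XH
        ≤ 99 / 100 * (5 / 8) * (xC + xM + xH + yC + yM + yH) + δ * (XC + XM + XH + YC + YM + YH)) :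
    ∑ a, ∑ b, c a b ≤ 5 / 8 * ((∑ a, if ε₁ ≤ σ a ∧ ∃ b, ε₁ ≤ ρ b ∧ Dep a b then
        σ' a * (1 - Real.log (x a) / Lg) else 0) + (∑ b, if ε₁ ≤ ρ b ∧ ∃ a, ε₁ ≤ σ a ∧ Dep a b
        then ρ' b * (1 - Real.log (y b) / Lg) else 0))
      + (ε₂ * ((∑ a, σ' a) * (∑ b, ρ' b)) + 2 * ε₁ * m * ((∑ a, σ' a) + (∑ b, ρ' b))
        + 2 * ((∑ a, σ' a) + (∑ b, ρ' b)) * ((m : ℝ) * m * h₁)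
        + ((∑ a, σ' a) + (∑ b, ρ' b)) ^ 2 * ((m : ℝ) * m) / M) := by
  -- `hM` is not needed: the square in `Hi` is completed with `M` itself (`far_kept_tail_le`)
  have _hM := hM
  have hx0 : ∀ a, 0 < x a := fun a => one_pos.trans_le (hx a)
  have hy0 : ∀ b, 0 < y b := fun b => one_pos.trans_le (hy b)
  -- depleted pairs are small: `log x + log y ≤ log A₀ ≤ 1.01 Lg`
  have hDepL : ∀ a b, Dep a b → Real.log (x a) + Real.log (y b) ≤ 101 / 100 * Lg := by
    intro a b hd
    rw [← Real.log_mul (hx0 a).ne' (hy0 b).ne']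
    exact (Real.log_le_log (mul_pos (hx0 a) (hy0 b)) (hsmall a b hd)).trans hA₀
  -- non-far pairs at an included level have area `≤ A₁` (`1 ≤ A₀ ≤ A₁` as the level is depleted)
  have hfar : ∀ a b, (ε₁ ≤ σ a ∧ ∃ b, ε₁ ≤ ρ b ∧ Dep a b) →
      Real.log (x a) + Real.log (y b) < 124 / 100 * Lg → x a * y b ≤ A₁ := by
    intro a b ha hlt
    obtain ⟨b', -, hd⟩ := ha.2
    have hA1 : 0 < A₁ := by
      have h1 := hsmall a b' hd
      have h2 : (0 : ℝ) < x a * y b' := mul_pos (hx0 a) (hy0 b')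
      linarith
    have hlt' : Real.log (x a * y b) < Real.log A₁ := by
      rw [Real.log_mul (hx0 a).ne' (hy0 b).ne']; linarith
    exact ((Real.log_lt_log_iff (mul_pos (hx0 a) (hy0 b)) hA1).1 hlt').le
  exact core σ σ' (fun a => Real.log (x a)) ρ ρ' (fun b => Real.log (y b)) h c Dep
    (fun a b => ε₁ ≤ σ a ∧ ε₁ ≤ ρ b ∧ h₁ ≤ h a b ∧ x a * y b ≤ A₁)
    (fun a => ε₁ ≤ σ a ∧ ∃ b, ε₁ ≤ ρ b ∧ Dep a b) (fun b => ε₁ ≤ ρ b ∧ ∃ a, ε₁ ≤ σ a ∧ Dep a b)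
    ε₁ ε₂ h₁ M Lg hε₁ hε₂ hh₁.le hLg hM0 hσ hρ hh0 hhσ hhρ hbudget hc hcdep hDepL
    (fun a b ha hb hd => ⟨⟨ha, b, hb, hd⟩, ⟨hb, a, ha, hd⟩⟩)
    (fun a b ht => hpen a b ht.1 ht.2.1 ht.2.2.1 ht.2.2.2)
    (fun a b ha hb hlt hnt => (not_le.1 fun hle => hnt ⟨ha.1, hb.1, hle, hfar a b ha hlt⟩).le)
    (fun a ha => hratex a ha.1 ha.2) (fun b hb => hratey b hb.1 hb.2) hscalar

end Summit.MatrixMultiplication.MatrixMultiplication.Theorems.PolynomialSlack
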